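import Summits.RiemannHypothesis.RiemannHypothesis.Theorems.Splittings.ScrewKreinCoreSymbol
import HarnessLib

/-!
# Screw index transfer via Kreĭn definitizability — analytic core, part 4/5: (B) preliminaries — holomorphy of
# Laplace transforms and `F_φ = f ∗ c_φ`

CUT 4/5 of `ScrewIndexTransferKreinCore` (rh-split-screw-bridge g5).  `differentiableOn_lap` (a bounded continuous
`F` has `Lap F` holomorphic on `Re w > 0`), the entire correction term `Hfun c w = ∫ c(u) e^{−wu} ∫_{−u}^0 f e^{−wt}`
(`differentiable_Hfun`, parametric integral over a compact triangle) — both via the tree's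
`Literature.Analysis.Complex.differentiableOn_integral_of_dominated` — and `transl_eq_conv : F_φ(s) = ∫ f(s−u) c_φ(u) du`
with `continuous_corr`, `hasCompactSupport_corr` (Fubini, `integrable_corrKernel`).

HONEST LABEL.  `CofiniteCriticalLine` (all but finitely many nontrivial zeros on the line) is NOT RH, and
ETAIL (eventual positivity of the screw pivots) is NOT the screw criterion `∀ M, 0 < screwPivot M`; this module is
part of a chain relating the two tails to each other and decides neither.  Nothing here bears on the truth of RH.
-/

noncomputable section

set_option linter.dupNamespace false

namespace Summit.RiemannHypothesis.RiemannHypothesis.Theorems.Splittings.ScrewKreinCore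

open Finset Complex MeasureTheory Set Filter Topology
open Literature.NumberTheory.LFunctions
open Literature.Analysis.OperatorTheory
open Summit.RiemannHypothesis.RiemannHypothesis.Theses.RuelleBand
open Summit.RiemannHypothesis.RiemannHypothesis.Theorems.IntegerScrew

/-! ## Towards (B): holomorphy of Laplace transforms (dominated parameter integrals) -/

/-- **(B1)** The one-sided Laplace transform of a bounded continuous function is holomorphic on
`Re w > 0`. [folklore] -/
theorem differentiableOn_lap {F : ℝ → ℂ} (hF : Continuous F) (C : ℝ) (hC : ∀ s, ‖F s‖ ≤ C) :
    DifferentiableOn ℂ (lap F) {w : ℂ | 0 < w.re} := by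
  refine Literature.Analysis.Complex.differentiableOn_integral_of_dominated
    (μ := volume.restrict (Ioi (0 : ℝ))) (F := fun (w : ℂ) (s : ℝ) => F s * cexp (-(w * s)))
    (fun w _ => (Continuous.aestronglyMeasurable (by fun_prop))) ?_ ?_
  · exact Eventually.of_forall fun s =>
      (by fun_prop : Differentiable ℂ fun w : ℂ => F s * cexp (-(w * s))).differentiableOn
  · intro x₀ hx₀
    have hσ : 0 < x₀.re := hx₀
    refine ⟨x₀.re / 2, by positivity, fun p hp => ?_, fun s => C * Real.exp (-(x₀.re / 2) * s),
      (exp_neg_integrableOn_Ioi 0 (by positivity)).const_mul C, ?_⟩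
    · have h := Metric.mem_ball.mp hp
      rw [dist_eq_norm] at h
      have := Complex.abs_re_le_norm (p - x₀)
      rw [Complex.sub_re] at this
      show 0 < p.re
      cases abs_le.mp (this.trans h.le); linarith
    · refine (ae_restrict_iff' measurableSet_Ioi).mpr (Eventually.of_forall fun s hs p hp => ?_)
      have h := Metric.mem_ball.mp hp
      rw [dist_eq_norm] at h
      have hre := Complex.abs_re_le_norm (p - x₀)
      rw [Complex.sub_re] at hre
      have hp' : x₀.re / 2 ≤ p.re := by cases abs_le.mp (hre.trans h.le); linarith
      rw [norm_mul, Complex.norm_exp]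
      have hexp : (-(p * (s : ℂ))).re = -(p.re * s) := by
        simp [Complex.mul_re, Complex.ofReal_re, Complex.ofReal_im]
      rw [hexp]
      refine mul_le_mul (hC s) (Real.exp_le_exp.mpr ?_) (Real.exp_pos _).le
        ((norm_nonneg _).trans (hC s))
      have : (0 : ℝ) < s := hs
      nlinarith

/-- Set integrals `∫_{Ioc a b} fC(t) e^{−wt} dt` are entire in `w`. -/
theorem differentiable_setIntegral_Ioc (a b : ℝ) :
    Differentiable ℂ fun w : ℂ => ∫ t in Ioc a b, fC t * cexp (-(w * t)) := by
  obtain ⟨M, hM⟩ := (isCompact_Icc : IsCompact (Icc a b)).exists_bound_of_continuousOn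
    (continuous_fC.continuousOn)
  rw [← differentiableOn_univ]
  refine Literature.Analysis.Complex.differentiableOn_integral_of_dominated
    (μ := volume.restrict (Ioc a b)) (F := fun (w : ℂ) (t : ℝ) => fC t * cexp (-(w * t)))
    (fun w _ => (Continuous.aestronglyMeasurable (continuous_fC.mul (by fun_prop)))) ?_ ?_
  · exact Eventually.of_forall fun t =>
      ((differentiable_const _).mul (by fun_prop) :
        Differentiable ℂ fun w : ℂ => fC t * cexp (-(w * t))).differentiableOn
  · intro x₀ _
    refine ⟨1, zero_lt_one, subset_univ _,
      fun _ => M * Real.exp ((‖x₀‖ + 1) * max |a| |b|), integrableOn_const ?_ , ?_⟩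
    · exact (measure_Ioc_lt_top (a := a) (b := b)).ne
    · refine (ae_restrict_iff' measurableSet_Ioc).mpr (Eventually.of_forall fun t ht p hp => ?_)
      have h := Metric.mem_ball.mp hp
      rw [dist_eq_norm] at h
      have hp' : ‖p‖ ≤ ‖x₀‖ + 1 := by
        calc ‖p‖ = ‖(p - x₀) + x₀‖ := by rw [sub_add_cancel]
          _ ≤ ‖p - x₀‖ + ‖x₀‖ := norm_add_le _ _
          _ ≤ ‖x₀‖ + 1 := by linarith
      have htK : |t| ≤ max |a| |b| := abs_le_max_abs_abs ht.1.le ht.2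
      rw [norm_mul, Complex.norm_exp]
      refine mul_le_mul (hM t ⟨ht.1.le, ht.2⟩) (Real.exp_le_exp.mpr ?_) (Real.exp_pos _).le
        ((norm_nonneg _).trans (hM t ⟨ht.1.le, ht.2⟩))
      calc (-(p * (t : ℂ))).re ≤ ‖-(p * (t : ℂ))‖ := Complex.re_le_norm _
        _ = ‖p‖ * |t| := by rw [norm_neg, norm_mul, Complex.norm_real, Real.norm_eq_abs]
        _ ≤ (‖x₀‖ + 1) * max |a| |b| :=
          mul_le_mul hp' htK (abs_nonneg t) (by positivity)


/-- The inner interval integral `I(u, w) = ∫_{−u}^{0} fC(t) e^{−wt} dt` is entire in `w`. -/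
theorem differentiable_innerInt (u : ℝ) :
    Differentiable ℂ fun w : ℂ => ∫ t in (-u)..0, fC t * cexp (-(w * t)) := by
  simp only [intervalIntegral]
  exact (differentiable_setIntegral_Ioc (-u) 0).sub (differentiable_setIntegral_Ioc 0 (-u))

/-- The correction term `H_c(w) = ∫ c(u) e^{−wu} ∫_{−u}^{0} fC(t) e^{−wt} dt du`. -/
def Hfun (c : ℝ → ℂ) (w : ℂ) : ℂ :=
  ∫ u : ℝ, c u * cexp (-(w * u)) * ∫ t in (-u)..0, fC t * cexp (-(w * t))

/-- The truncated one-sided Laplace integral `u ↦ ∫_{−u}^0 f(t) e^{−wt} dt` is continuous in `u`. -/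
theorem continuous_innerInt (w : ℂ) :
    Continuous fun u : ℝ => ∫ t in (-u)..0, fC t * cexp (-(w * t)) := by
  have hP : Continuous fun b : ℝ => ∫ t in (0 : ℝ)..b, fC t * cexp (-(w * t)) :=
    intervalIntegral.continuous_primitive
      (fun a b => (continuous_fC.mul (by fun_prop)).intervalIntegrable a b) 0
  have : (fun u : ℝ => ∫ t in (-u)..0, fC t * cexp (-(w * t))) =
      fun u => -((fun b : ℝ => ∫ t in (0 : ℝ)..b, fC t * cexp (-(w * t))) (-u)) := by
    funext u
    show _ = -(∫ t in (0 : ℝ)..(-u), fC t * cexp (-(w * t)))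
    exact intervalIntegral.integral_symm 0 (-u)
  rw [this]
  exact (hP.comp continuous_neg).neg

/-- **(B4)** `H_c` is entire for `c` continuous with compact support. [folklore] -/
theorem differentiable_Hfun {c : ℝ → ℂ} (hc : Continuous c) (hcs : HasCompactSupport c) :
    Differentiable ℂ (Hfun c) := by
  obtain ⟨L, hL⟩ := hcs.isCompact.isBounded.subset_closedBall 0
  have hc0 : ∀ u, L < |u| → c u = 0 := fun u hu => image_eq_zero_of_notMem_tsupport fun h => by
    have := hL h; rw [Metric.mem_closedBall, dist_zero_right, Real.norm_eq_abs] at this; linarith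
  obtain ⟨M, hM⟩ := (isCompact_Icc : IsCompact (Icc (-|L|) |L|)).exists_bound_of_continuousOn
    (continuous_fC.continuousOn)
  have hM0 : 0 ≤ M := (norm_nonneg _).trans (hM 0 ⟨by simp, by simp⟩)
  rw [← differentiableOn_univ]
  refine Literature.Analysis.Complex.differentiableOn_integral_of_dominated (μ := volume)
    (F := fun (w : ℂ) (u : ℝ) => c u * cexp (-(w * u)) * ∫ t in (-u)..0, fC t * cexp (-(w * t)))
    (fun w _ => ((hc.mul (by fun_prop)).mul (continuous_innerInt w)).aestronglyMeasurable) ?_ ?_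
  · exact Eventually.of_forall fun u =>
      ((((differentiable_const _).mul (by fun_prop)).mul (differentiable_innerInt u)) :
        Differentiable ℂ fun w : ℂ =>
          c u * cexp (-(w * u)) * ∫ t in (-u)..0, fC t * cexp (-(w * t))).differentiableOn
  · intro x₀ _
    set E : ℝ := Real.exp ((‖x₀‖ + 1) * |L|) with hE
    refine ⟨1, zero_lt_one, subset_univ _, fun u => ‖c u‖ * (E * (M * E * |L|)), ?_, ?_⟩
    · exact ((continuous_norm.comp hc).mul continuous_const).integrable_of_hasCompactSupport
        (HasCompactSupport.intro hcs fun u hu => by simp [image_eq_zero_of_notMem_tsupport hu])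
    · refine Eventually.of_forall fun u p hp => ?_
      have h := Metric.mem_ball.mp hp
      rw [dist_eq_norm] at h
      have hp' : ‖p‖ ≤ ‖x₀‖ + 1 := by
        calc ‖p‖ = ‖(p - x₀) + x₀‖ := by rw [sub_add_cancel]
          _ ≤ ‖p - x₀‖ + ‖x₀‖ := norm_add_le _ _
          _ ≤ ‖x₀‖ + 1 := by linarith
      by_cases hu : L < |u|
      · simp [hc0 u hu]
      have huL : |u| ≤ |L| := (not_lt.mp hu).trans (le_abs_self L)
      have hexp : ∀ t : ℝ, |t| ≤ |L| → ‖cexp (-(p * t))‖ ≤ E := fun t ht => by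
        rw [Complex.norm_exp, hE, Real.exp_le_exp]
        calc (-(p * (t : ℂ))).re ≤ ‖-(p * (t : ℂ))‖ := Complex.re_le_norm _
          _ = ‖p‖ * |t| := by rw [norm_neg, norm_mul, Complex.norm_real, Real.norm_eq_abs]
          _ ≤ (‖x₀‖ + 1) * |L| := mul_le_mul hp' ht (abs_nonneg t) (by positivity)
      have hI : ‖∫ t in (-u)..0, fC t * cexp (-(p * t))‖ ≤ M * E * |L| := by
        have h1 := intervalIntegral.norm_integral_le_of_norm_le_const (a := -u) (b := 0)
          (C := M * E) (f := fun t => fC t * cexp (-(p * t))) fun t ht => by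
            have htu : |t| ≤ |u| := by
              rcases Set.mem_uIoc.mp ht with ⟨h1, h2⟩ | ⟨h1, h2⟩
              · rw [abs_le]; constructor <;> linarith [le_abs_self u, neg_abs_le u]
              · rw [abs_le]; constructor <;> linarith [le_abs_self u, neg_abs_le u]
            rw [norm_mul]
            exact mul_le_mul (hM t ⟨by linarith [abs_le.mp (htu.trans huL)],
              by linarith [abs_le.mp (htu.trans huL)]⟩) (hexp t (htu.trans huL)) (norm_nonneg _) hM0
        calc ‖∫ t in (-u)..0, fC t * cexp (-(p * t))‖ ≤ M * E * |0 - -u| := h1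
          _ = M * E * |u| := by rw [sub_neg_eq_add, zero_add]
          _ ≤ M * E * |L| := mul_le_mul_of_nonneg_left huL (by positivity)
      calc ‖c u * cexp (-(p * u)) * ∫ t in (-u)..0, fC t * cexp (-(p * t))‖
          = ‖c u‖ * (‖cexp (-(p * u))‖ * ‖∫ t in (-u)..0, fC t * cexp (-(p * t))‖) := by
            rw [norm_mul, norm_mul, mul_assoc]
        _ ≤ ‖c u‖ * (E * (M * E * |L|)) :=
            mul_le_mul_of_nonneg_left (mul_le_mul (hexp u huL) hI (norm_nonneg _)
              (Real.exp_pos _).le) (norm_nonneg _)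


/-! ## Towards (B): `F_φ = fC ∗ c_φ` (B2) -/

/-- Kernels `(u, x) ↦ m(u) · A(x) · conj(A(x+u))` with `A` compactly supported are integrable. -/
theorem integrable_corrKernel {A : ℝ → ℂ} (hA : Continuous A) (hAs : HasCompactSupport A)
    {m : ℝ → ℂ} (hm : Continuous m) :
    Integrable (Function.uncurry fun u x : ℝ => m u * (A x * (starRingEnd ℂ) (A (x + u))))
      (volume.prod volume) := by
  obtain ⟨R, hR⟩ := hAs.isCompact.isBounded.subset_closedBall 0
  have hA0 : ∀ x, R < |x| → A x = 0 := fun x hx => image_eq_zero_of_notMem_tsupport fun h => by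
    have := hR h; rw [Metric.mem_closedBall, dist_zero_right, Real.norm_eq_abs] at this; linarith
  refine Continuous.integrable_of_hasCompactSupport ?_ ?_
  · exact (hm.comp continuous_fst).mul ((hA.comp continuous_snd).mul
      (Complex.continuous_conj.comp (hA.comp (continuous_snd.add continuous_fst))))
  · refine HasCompactSupport.intro
      ((isCompact_closedBall (0 : ℝ) (2 * R)).prod (isCompact_closedBall (0 : ℝ) R)) fun p hp => ?_
    rw [Set.mem_prod, not_and_or] at hp
    simp only [Metric.mem_closedBall, dist_zero_right, Real.norm_eq_abs, not_le] at hp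
    rcases hp with h | h
    · by_cases hx : R < |p.2|
      · simp [Function.uncurry, hA0 _ hx]
      · have h2 : R < |p.2 + p.1| := by
          have : |p.1| ≤ |p.2 + p.1| + |p.2| := by
            calc |p.1| = |p.2 + p.1 - p.2| := by rw [add_sub_cancel_left]
              _ ≤ |p.2 + p.1| + |p.2| := abs_sub _ _
          linarith [not_lt.mp hx]
        simp [Function.uncurry, hA0 _ h2]
    · simp [Function.uncurry, hA0 _ h]

/-- The autocorrelation `corr Q φ` is continuous for a test function `φ`. -/
theorem continuous_corr (Q : Polynomial ℂ) {φ : ℝ → ℂ} (hφ : IsTest φ) : Continuous (corr Q φ) := by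
  have hA : Continuous (applyQ Q φ) := continuous_applyQ Q hφ
  have hAs : HasCompactSupport (applyQ Q φ) := hasCompactSupport_applyQ Q hφ
  have h : corr Q φ = fun u => ∫ x in tsupport (applyQ Q φ),
      applyQ Q φ x * (starRingEnd ℂ) (applyQ Q φ (x + u)) := by
    funext u
    rw [corr, setIntegral_eq_integral_of_forall_compl_eq_zero]
    intro x hx
    simp [image_eq_zero_of_notMem_tsupport hx]
  rw [h]
  exact continuous_parametric_integral_of_continuous
    ((hA.comp continuous_snd).mul
      (Complex.continuous_conj.comp (hA.comp (continuous_snd.add continuous_fst)))) hAs.isCompact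

/-- The autocorrelation `corr Q φ` has compact support for a test function `φ`. -/
theorem hasCompactSupport_corr (Q : Polynomial ℂ) {φ : ℝ → ℂ} (hφ : IsTest φ) :
    HasCompactSupport (corr Q φ) := by
  have hAs : HasCompactSupport (applyQ Q φ) := hasCompactSupport_applyQ Q hφ
  obtain ⟨R, hR⟩ := hAs.isCompact.isBounded.subset_closedBall 0
  have hA0 : ∀ x, R < |x| → applyQ Q φ x = 0 := fun x hx =>
    image_eq_zero_of_notMem_tsupport fun h => by
      have := hR h; rw [Metric.mem_closedBall, dist_zero_right, Real.norm_eq_abs] at this; linarith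
  refine HasCompactSupport.intro (isCompact_closedBall (0 : ℝ) (2 * R)) fun u hu => ?_
  rw [Metric.mem_closedBall, dist_zero_right, Real.norm_eq_abs, not_le] at hu
  have h0 : ∀ x, applyQ Q φ x * (starRingEnd ℂ) (applyQ Q φ (x + u)) = 0 := by
    intro x
    by_cases hx : R < |x|
    · simp [hA0 _ hx]
    · have h2 : R < |x + u| := by
        have : |u| ≤ |x + u| + |x| := by
          calc |u| = |x + u - x| := by rw [add_sub_cancel_left]
            _ ≤ |x + u| + |x| := abs_sub _ _
        linarith [not_lt.mp hx]
      simp [hA0 _ h2]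
  simp [corr, h0]

/-- **(B2)** `F_φ(s) = ∫ fC(s − u) c_φ(u) du`. -/
theorem transl_eq_conv (Q : Polynomial ℂ) {φ : ℝ → ℂ} (hφ : IsTest φ) (s : ℝ) :
    transl Q φ s = ∫ u, fC (s - u) * corr Q φ u := by
  have hA : Continuous (applyQ Q φ) := continuous_applyQ Q hφ
  have hAs : HasCompactSupport (applyQ Q φ) := hasCompactSupport_applyQ Q hφ
  symm
  unfold corr transl
  calc (∫ u, fC (s - u) * ∫ x, applyQ Q φ x * (starRingEnd ℂ) (applyQ Q φ (x + u)))
      = ∫ u, ∫ x, fC (s - u) * (applyQ Q φ x * (starRingEnd ℂ) (applyQ Q φ (x + u))) := by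
        congr 1; funext u; rw [← integral_const_mul]
    _ = ∫ x, ∫ u, fC (s - u) * (applyQ Q φ x * (starRingEnd ℂ) (applyQ Q φ (x + u))) :=
        integral_integral_swap
          (integrable_corrKernel hA hAs (continuous_fC.comp (continuous_const.sub continuous_id)))
    _ = ∫ x, ∫ y, fC (x + s - y) * applyQ Q φ x * (starRingEnd ℂ) (applyQ Q φ y) := by
        congr 1; funext x
        have h1 : (fun u => fC (s - u) * (applyQ Q φ x * (starRingEnd ℂ) (applyQ Q φ (x + u)))) =
            fun u => (fun y => fC (x + s - y) * applyQ Q φ x * (starRingEnd ℂ) (applyQ Q φ y))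
              (x + u) := by
          funext u; simp only; rw [show x + s - (x + u) = s - u by ring]; ring
        rw [h1]
        exact integral_add_left_eq_self
          (fun y => fC (x + s - y) * applyQ Q φ x * (starRingEnd ℂ) (applyQ Q φ y)) x

end Summit.RiemannHypothesis.RiemannHypothesis.Theorems.Splittings.ScrewKreinCore

end
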